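import Mathlib
import Summits.ValiantsHypothesis.ValiantsHypothesis.Theorems.NewtonUnitEquationsDissociatedUniformTotalsLaw
import Summits.ValiantsHypothesis.ValiantsHypothesis.Theorems.NewtonUnitEquationsDissociatedUniformTotalsLawSubCubic
import HarnessLib

/-!
# Crux `NewtonUnitEquations.DissociatedUniform` (stmt-ValiantsHypothesis-5905), `n = 3` totals law of model (Q**):
# the sub-cubic bound in real-exponent and cyclic forms

Corollaries of `…TotalsLawSubCubic.totalVert_le_sqrt` (`T ≤ 108(⌊√|G|⌋ + 1)|G|²` for every finite abelian `G` and all curves):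
* `totalVert_le_rpow` — `(T : ℝ) ≤ 216 · |G|^{5/2}` (real exponent; `⌊√q⌋ + 1 ≤ 2√q` for `q ≥ 1`);
* `totalVert_zmod_le` — the literal (Q**) case `G = ZMod q`: `T ≤ 108 (⌊√q⌋ + 1) q²` (compare the OPEN `TotalsLawThreeCyclic C : T ≤ C q²`).
Nothing here bears on `TotalsLawThree` (OPEN) or on VP ≠ VNP.
[folklore]
-/

set_option linter.dupNamespace false -- `ValiantsHypothesis.ValiantsHypothesis` (summit = problem) in every name

namespace Summit.ValiantsHypothesis.ValiantsHypothesis.Theorems.NewtonUnitEquationsDissociatedUniform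

namespace TotalsLaw

variable {G : Type*} [AddCommGroup G] [Fintype G]

/-- **`T ≤ 216 · |G|^{5/2}`** (real-exponent form of the sub-cubic bound). [folklore] -/
theorem totalVert_le_rpow (a b c : G → (Fin 2 → ℝ)) :
    (totalVert a b c : ℝ) ≤ 216 * (Fintype.card G : ℝ) ^ ((5 : ℝ) / 2) := by
  classical
  set q := Fintype.card G with hq
  have h := totalVert_le_sqrt a b c
  have hq1 : (1 : ℝ) ≤ q := by exact_mod_cast (Fintype.card_pos : 0 < q)
  have hq0 : (0 : ℝ) ≤ q := by linarith
  -- `⌊√q⌋ + 1 ≤ 2 √q`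
  have hk : ((Nat.sqrt q : ℕ) : ℝ) ≤ Real.sqrt q := by
    rw [Real.le_sqrt (by positivity) hq0]
    exact_mod_cast (Nat.sqrt_le' q : Nat.sqrt q ^ 2 ≤ q)
  have hs1 : (1 : ℝ) ≤ Real.sqrt q := by rw [Real.le_sqrt (by norm_num) hq0]; simpa using hq1
  have hk1 : ((Nat.sqrt q : ℕ) : ℝ) + 1 ≤ 2 * Real.sqrt q := by linarith
  -- `q^{5/2} = q² √q`
  have hpow : (q : ℝ) ^ ((5 : ℝ) / 2) = (q : ℝ) ^ 2 * Real.sqrt q := by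
    rw [Real.sqrt_eq_rpow, ← Real.rpow_natCast, ← Real.rpow_add' hq0 (by norm_num)]
    norm_num
  rw [hpow]
  have h' : (totalVert a b c : ℝ) ≤ 108 * (((Nat.sqrt q : ℕ) : ℝ) + 1) * (q : ℝ) ^ 2 := by exact_mod_cast h
  calc (totalVert a b c : ℝ) ≤ 108 * (((Nat.sqrt q : ℕ) : ℝ) + 1) * (q : ℝ) ^ 2 := h'
    _ ≤ 108 * (2 * Real.sqrt q) * (q : ℝ) ^ 2 := by gcongr
    _ = 216 * ((q : ℝ) ^ 2 * Real.sqrt q) := by ring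

/-- **The literal (Q**) case**: over `ZMod q`, `T ≤ 108 (⌊√q⌋ + 1) q²`. [folklore] -/
theorem totalVert_zmod_le (q : ℕ) [NeZero q] (a b c : ZMod q → (Fin 2 → ℝ)) :
    totalVert a b c ≤ 108 * (Nat.sqrt q + 1) * q ^ 2 := by
  simpa [ZMod.card] using totalVert_le_sqrt a b c

end TotalsLaw

end Summit.ValiantsHypothesis.ValiantsHypothesis.Theorems.NewtonUnitEquationsDissociatedUniform
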